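import Summits.BirchSwinnertonDyer.BirchSwinnertonDyer.Theorems.ClassRecordThreeEulerHalvesAtThreeOfExceptionalZeroRoad

/-!
# BC3 LINE-CANDIDATE skeleton `exz` for crux `EulerHalvesAtThree` (item stmt-BirchSwinnertonDyer-19109;
# routes `ClassRecordThree` r5 and `KolyvaginRoadThree`) — the EXCEPTIONAL-ZERO ROAD as a second supplier
# (cell `bsd-stepL`, seat `bsd-stepL-mult-p4` g3, 2026-08-27; OFFER to the planner — memo
# `HOME/mult-p4/EXZ-ROAD-MEMO-g2.md` §6 R5 and `EXZ-ROAD-MEMO-g3.md` §5 R11; NOT registered by this seat)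

The crux (three clauses: (1) `Ram → ShapeAlpha → upper`, (2) `Ram → split → ¬ShapeAlpha → ShapeGamma →
upper`, (3) `Surj → ¬Ram → upper`, upper = `Typed.MissingUpperBoundAt W 3`) BY NAME from
`PublishedInputsThree` (item 19112, by name) and THREE stubs, through the landed certificate
`ExceptionalZeroRoad.classRecordThree_eulerHalvesAtThree_of_publishedInputs_of_conjecture_of_regulatorNonvanishing`
(p545447, `Theorems/ClassRecordThreeEulerHalvesAtThreeOfExceptionalZeroRoad.lean`): Kato's divisibility
in Wuthrich's surjective shape (the `3`-adic tower is onto on X11b@3 ∩ `Surj` — tree THEOREM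
`Rank1Residual.surjective_pow_of_mult_of_surj`; `Surj` automatic on (ram) — `surj_of_irr_of_ram`) read
through the two `3`-adic leading terms (Jones ∕ Stein–Wuthrich Thm. 6.1; the `p`-adic Gross–Zagier
display at the pair), TAMAGAWA-BLIND — the places `3 ∣ ∏ c_ℓ` where Kolyvagin's index loses units are
invisible on this road. No Skinner 2016 ∕ Skinner–Urban statement is used (no FLAG
`SU14-12.3.6-mu@nonsplit@3`).

Stubs (sorries ONLY here):
* `stub_exzNamedPrintAtThree` (CITABLE, by Literature decl name) — Kato–Wuthrich surjective divisibility
  `Wuthrich2014.kato_charIdeal_dvd_multiplicative_of_surjective`, Stein–Wuthrich Thm. 6.1 SPLIT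
  `SteinWuthrich2013.thm61_splitMultiplicative`, the split canonical §4.2 height
  `SteinWuthrich2013.exists_isSplitMultCanonical` (the three PUBLISHED facts the class record's
  `PublishedInputsThree` does not carry).
* `stub_relativeLeadingTermAtThreeSplitSurj` (OPEN — the road's one analytic input): the exceptional
  rank-one display `ClassClosure.RelativeExceptionalLeadingTermAt W 3` (EVIDENCE-labelled conjecture of the
  tree, X11-REPORT v3 150∕150 at `p = 3`) on SPLIT X11b@3 ∩ `Surj` pairs. GRADE (memo g3 §2–§3): on every
  pair with a SECOND multiplicative prime (all (ram) pairs — clauses (1)–(2); the clause-(3) pairs with an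
  `E[3]`-unramified multiplicative `ℓ ≠ 3`) it is Disegni 2020 Thm. 4 (second bullet, exact form) read at
  `p = 3` = Venerucci 2016 Thm. D + Bertolini–Darmon 2007 Thm. 5.4 + Disegni Props. 4–5, whose bricks are
  ALL located in print at `p = 3` (Hida control ∕ freeness: Hida EMI Thms. 4.1.24 ∕ 4.1.26 ∕ 4.1.29, cell
  T11; Mazur–Tilouine Thm. 7 `p ≥ 3`; Ochiai 2003 ∕ 2006 `p ≥ 3`; Kobayashi 2006 `p ≥ 3`; BD07 body,
  Disegni Props. 4–5, Nekovář, Kato: no `p`-condition) modulo THREE verification ticks (V-B3: the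
  Greenberg–Stevens two-variable function — Thm. 5.13 ∕ 5.15, Prop. 6.1, improved factorisation — at `3`
  from EMI + EPW06; V-B4: `𝓛^{GS} = 𝓛^{Tate}` at `3`, discharged in the memo by a twist comparison
  (Kobayashi 2006 + Friedberg–Hoffstein) modulo V-B3; V-B6′: BD07 Thm. 2.5, the quaternionic family, at
  `3`) — AUDIT-PENDING, not a void; on the clause-(3) pairs where `3` is the ONLY multiplicative prime it is
  in print only up to `ℚ^×` at every `p` (Mok 2011 ∕ Disegni Thm. 4: a period-commensurability conjecture).
* `stub_regulatorNonvanishingAtThreeSurj` (OPEN = rung I1's object at `3` on X11b@3 ∩ `Surj`; crux 19106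
  `SchneiderAtThree` is its restriction to NON-split (ram) pairs): Schneider's non-degeneracy of THE §4.2
  datum, `ClassClosure.RegulatorNonvanishingAt W 3`; per pair a REGMULT certificate (960∕961 split (ram),
  723∕723 non-split (ram) B10 rows CERT of record; ¬(ram) rows: DATA ASK D-f), class-wide open.
Compositions `EulerHalvesAtThree_of` (route `ClassRecordThree`) and `EulerHalvesAtThree_of'`
(`KolyvaginRoadThree` twin). Nothing is asserted about any curve (T7); CONDITIONAL; closes nothing.
-/

set_option linter.dupNamespace false
set_option autoImplicit false

noncomputable section

open scoped Classical

namespace Summit.BirchSwinnertonDyer.BirchSwinnertonDyer.Cruxes.EulerHalvesAtThree.Exz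

open WeierstrassCurve Literature.NumberTheory.EllipticCurves
  Literature.NumberTheory.EllipticCurves.Rank1Residual
  Literature.NumberTheory.EllipticCurves.SteinWuthrich2013
  Literature.NumberTheory.EllipticCurves.Wuthrich2014
  Summit.BirchSwinnertonDyer.Rank1Residual Summit.BirchSwinnertonDyer.Rank1Residual.X11b
  Summit.BirchSwinnertonDyer.BirchSwinnertonDyer.Theorems.ExceptionalZeroRoad

/-- **STUB (CITABLE — by Literature decl name)**: the three PUBLISHED named facts of the road that
`PublishedInputsThree` does not carry — Kato's divisibility `char X ∣ ϖ·L_p` at a multiplicative prime in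
Wuthrich's surjective shape, Stein–Wuthrich Thm. 6.1 (split case: order of vanishing and leading term of
the algebraic `p`-adic `L`-function with the `𝓛`-invariant), and the existence of the split-canonical
§4.2 `p`-adic height datum. [cite: Wuthrich2014, Thm. 3, Cor. 19] [cite: SteinWuthrich2013, Thm. 6.1, §4.2] -/
theorem stub_exzNamedPrintAtThree :
    kato_charIdeal_dvd_multiplicative_of_surjective ∧ thm61_splitMultiplicative ∧
      exists_isSplitMultCanonical := by
  sorry

/-- **STUB (OPEN — the road's analytic input; AUDIT-PENDING on pairs with a second multiplicative prime,
beyond print (`ℚ^×` only) on `3`-only pairs)**: the exceptional rank-one display at `p = 3` on split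
X11b@3 ∩ `Surj` pairs — Mazur–Tate–Teitelbaum's exceptional `p`-adic BSD formula RELATIVE to the
classical one, `ϖ·[T²]L·(log₃ γ)²·#T² = u·𝓛₃(E)·#Ш_an·Reg₃(E,Dh)·∏ c_v`, `u ∈ ℤ₃ˣ` (tree conjecture
`ClassClosure.RelativeExceptionalLeadingTermAt W 3`; Disegni 2020 Thm. 4 second bullet read at `p = 3`).
[cite: Disegni2020, Thm. 4 (§3.2), second bullet — printed for p ≥ 5; shape only at p = 3]
[cite: Venerucci2015, Thm. D] [cite: MazurTateTeitelbaum1986Invent, §II.10] -/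
theorem stub_relativeLeadingTermAtThreeSplitSurj :
    ∀ (W : WeierstrassCurve ℚ) [W.IsElliptic] [W.IsGloballyMinimal], ClassX11b W 3 → Surj W 3 →
      W.HasSplitMultiplicativeReductionAtPrime 3 → ClassClosure.RelativeExceptionalLeadingTermAt W 3 := by
  sorry

/-- **STUB (OPEN = rung I1 at `3` on X11b@3 ∩ `Surj`)**: Schneider's non-degeneracy of the cyclotomic
`3`-adic height of THE Stein–Wuthrich §4.2 datum (both pinnings), `ClassClosure.RegulatorNonvanishingAt W 3`;
crux 19106 `SchneiderAtThree` is the restriction to non-split (ram) pairs. Per pair a finite certificate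
(REGMULT rows); class-wide Schneider's conjecture in rank one.
[cite: Schneider1982PadicHeightI, §1] [cite: SteinWuthrich2013, §4.2, Conj. 4.1] -/
theorem stub_regulatorNonvanishingAtThreeSurj :
    ∀ (W : WeierstrassCurve ℚ) [W.IsElliptic] [W.IsGloballyMinimal], ClassX11b W 3 → Surj W 3 →
      ClassClosure.RegulatorNonvanishingAt W 3 := by
  sorry

/-- **Composition**: the crux BY NAME from `PublishedInputsThree` (item 19112, by name: conjuncts 6, 15,
16, 17, 18 = GZK, SW Thm. 6.1 non-split, the non-split canonical height, Disegni Thm. 1, modular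
parametrisations) and the three stubs, through p545447's packaging theorem. -/
theorem EulerHalvesAtThree_of
    (h : Summit.BirchSwinnertonDyer.BirchSwinnertonDyer.Theses.ClassRecordThree.PublishedInputsThree) :
    Summit.BirchSwinnertonDyer.BirchSwinnertonDyer.Theses.ClassRecordThree.EulerHalvesAtThree :=
  classRecordThree_eulerHalvesAtThree_of_publishedInputs_of_conjecture_of_regulatorNonvanishing h
    stub_exzNamedPrintAtThree.1 stub_exzNamedPrintAtThree.2.1 stub_exzNamedPrintAtThree.2.2
    stub_relativeLeadingTermAtThreeSplitSurj stub_regulatorNonvanishingAtThreeSurj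

/-- **The `KolyvaginRoadThree` twin** (same statement; facts 6, 15, 16, 17, 18 of `PublishedInputsThree`
destructured and fed to p545447's KOLY certificate). -/
theorem EulerHalvesAtThree_of'
    (h : Summit.BirchSwinnertonDyer.BirchSwinnertonDyer.Theses.ClassRecordThree.PublishedInputsThree) :
    Summit.BirchSwinnertonDyer.BirchSwinnertonDyer.Theses.KolyvaginRoadThree.EulerHalvesAtThree := by
  obtain ⟨-, -, -, -, -, hGZK, -, -, -, -, -, -, -, -, hJn, hHn, hDf, hpar, -, -⟩ := h
  exact kolyvaginRoadThree_eulerHalvesAtThree_of_conjecture_of_regulatorNonvanishing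
    stub_exzNamedPrintAtThree.1 stub_exzNamedPrintAtThree.2.1 hJn stub_exzNamedPrintAtThree.2.2 hHn hDf
    hGZK hpar stub_relativeLeadingTermAtThreeSplitSurj stub_regulatorNonvanishingAtThreeSurj

end Summit.BirchSwinnertonDyer.BirchSwinnertonDyer.Cruxes.EulerHalvesAtThree.Exz

end
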